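import Summits.CriticalPhenomena.CardyFormulaZ2.Theorems.CardyComplexConeParafermionToSLESixFamiliesDiamondDefsR4
import Summits.CriticalPhenomena.CardyFormulaZ2.Theorems.CardyComplexConeParafermionToSLESixFamiliesDiamondArcsLap
import Summits.CriticalPhenomena.CardyFormulaZ2.Theorems.CardyComplexConeParafermionToSLESixFamiliesDiamondArcsFrame
import Summits.CriticalPhenomena.CardyFormulaZ2.Theorems.CardyComplexConeParafermionToSLESixFamiliesDiamondArcsWalk
import HarnessLib

/-!
# S1c `stub_diamondArcsConnected`: the discrete arcs of a diamond discretisation are connected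
# (line `potential-darboux-picard-diamond`, crux `ParafermionToSLESixFamilies`, stmt-CriticalPhenomena-11389)

The stub `stub_diamondArcsConnected : DiamondArcsConnected` of the checked skeleton (reshape r4): along an admissible
family of a marked diamond, eventually in `δ`, the wired discrete arc `zdArcA` is connected through `Ω_δ` and the
dual-wired one `zdArcB` through lattice edges — the hypotheses (H1)/(H2) of `passesCorner_iff_reachable_of_touch`,
consumed by the assembly S1‴.

Proof (parts 1–3 are the landed helpers `…DiamondArcsLap`, `…DiamondArcsFrame`, `…DiamondArcsWalk`): for small `δ`
every lattice point of the open diamond lies in `Ω_δ` (`eventually_mem_meshDomain_of_isMarkedDiamond`), these points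
form a box `a ≤ x₀ + x₁ ≤ b, a' ≤ x₁ − x₀ ≤ b'` (`diamondArcs_exists_box`), the discrete boundary is EXACTLY its two-layer
frame (`diamondArcs_zdBoundary_iff_frame`), and the boundary lap (`diamondArcs_exists_lap`) is a simple closed
`Ω_δ`-walk through all frame sites but the (at most four) apexes, each of which hangs off a lap site by an `Ω_δ`-edge
bordering no inner face — hence of the same arc, by `IsZdAdmissible.zdABEdges_inner`. Admissibility 2-colours the lap
by the disjoint arcs with exactly two `A`–`B` edges, so the lap lemma (`diamondArcs_reachable_of_lap`) joins any two
sites of one arc inside that arc along the lap. Connectivity through `Ω_δ` implies connectivity through `ℤ²`.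
-/

noncomputable section

namespace Summit.CriticalPhenomena.CardyFormulaZ2.Cruxes.ParafermionToSLESixFamilies.PotentialDarbouxPicardDiamond

open scoped Topology
open Filter Set Metric Complex
open Literature.Probability Literature.Probability.LatticeModels Literature.Probability.Percolation
open Literature.Probability.LatticeModels.DiscreteDobrushin
open Literature.Probability.RandomPlanarGeometry
open Summit.CriticalPhenomena.CardyFormulaZ2.Cruxes.ParafermionToSLESixFamilies.IicTraceFluxPairing (IsFamily)
open Summit.CriticalPhenomena.CardyFormulaZ2.Cruxes.BoundaryDefectGaussianR.RainbowMonomialsInExcursionKernels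
  (neighbour_coords)

namespace ArcsConn

/-! ## The arcs of a box datum -/

section Core

variable {Ω : Set ℂ} (hconv : Convex ℝ Ω) {δ : ℝ} (hgood : ∀ x : Site 2, meshPoint δ x ∈ Ω → x ∈ meshDomain Ω δ)
  {E : DiscreteDobrushin} (hΩ : E.Ω = Ω) (hEδ : E.δ = δ) {a b a' b' : ℤ}
  (hbox : ∀ x : Site 2, meshPoint δ x ∈ Ω ↔ (a ≤ x 0 + x 1 ∧ x 0 + x 1 ≤ b ∧ a' ≤ x 1 - x 0 ∧ x 1 - x 0 ≤ b'))
  (hba : 6 ≤ b - a) (hba' : 6 ≤ b' - a')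

include hba hba' in
/-- **The anchor of an apex**: an apex `(s, d) ∈ {a, b} × {a', b'}` of the box hangs off a non-apex frame site by a
lattice edge. -/
theorem exists_anchor {x : Site 2} (hx : (x 0 + x 1 = a ∨ x 0 + x 1 = b) ∧ (x 1 - x 0 = a' ∨ x 1 - x 0 = b')) :
    ∃ y : Site 2, ((a ≤ y 0 + y 1 ∧ y 0 + y 1 ≤ b ∧ a' ≤ y 1 - y 0 ∧ y 1 - y 0 ≤ b') ∧
      (y 0 + y 1 ≤ a + 1 ∨ b - 1 ≤ y 0 + y 1 ∨ y 1 - y 0 ≤ a' + 1 ∨ b' - 1 ≤ y 1 - y 0)) ∧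
      ¬ ((y 0 + y 1 = a ∨ y 0 + y 1 = b) ∧ (y 1 - y 0 = a' ∨ y 1 - y 0 = b')) ∧ (zdGraph 2).Adj x y := by
  obtain ⟨n0p, n0m, n1p, n1m⟩ := neighbour_coords x
  obtain ⟨hs | hs, hd | hd⟩ := hx
  · -- `s = a`, `d = a'`: anchor `x + e₁`
    refine ⟨x + Pi.single 1 1, ?_, ?_, (zdGraph_adj_iff _ _).2 ⟨1, Or.inl rfl⟩⟩ <;> rw [n1p.1, n1p.2] <;> omega
  · -- `s = a`, `d = b'`: anchor `x + e₀`
    refine ⟨x + Pi.single 0 1, ?_, ?_, (zdGraph_adj_iff _ _).2 ⟨0, Or.inl rfl⟩⟩ <;> rw [n0p.1, n0p.2] <;> omega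
  · -- `s = b`, `d = a'`: anchor `x − e₀`
    refine ⟨x - Pi.single 0 1, ?_, ?_, (zdGraph_adj_iff _ _).2 ⟨0, Or.inr (by simp)⟩⟩ <;> rw [n0m.1, n0m.2] <;> omega
  · -- `s = b`, `d = b'`: anchor `x − e₁`
    refine ⟨x - Pi.single 1 1, ?_, ?_, (zdGraph_adj_iff _ _).2 ⟨1, Or.inr (by simp)⟩⟩ <;> rw [n1m.1, n1m.2] <;> omega

include hconv hgood hbox in
/-- **Inside the box, `Ω_δ`-adjacency is lattice adjacency.** -/
theorem adj_iff_of_mem_box {x y : Site 2} (hx : a ≤ x 0 + x 1 ∧ x 0 + x 1 ≤ b ∧ a' ≤ x 1 - x 0 ∧ x 1 - x 0 ≤ b')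
    (hy : a ≤ y 0 + y 1 ∧ y 0 + y 1 ≤ b ∧ a' ≤ y 1 - y 0 ∧ y 1 - y 0 ≤ b') :
    (discreteDomainGraph Ω δ).Adj x y ↔ (zdGraph 2).Adj x y := by
  refine ⟨fun h => meshGraph_le_zdGraph Ω δ (discreteDomainGraph_le_meshGraph Ω δ h), fun h => ?_⟩
  rw [discreteDomainGraph_adj_iff]
  exact ⟨meshGraph_adj_of_convex hconv h ((hbox x).2 hx) ((hbox y).2 hy), hgood x ((hbox x).2 hx),
    hgood y ((hbox y).2 hy)⟩

include hΩ hEδ hbox in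
/-- **An apex is a corner of no inner face** (every face at an apex has a corner outside the box). -/
theorem apex_no_innerFace {x f : Site 2} (hx : (x 0 + x 1 = a ∨ x 0 + x 1 = b) ∧ (x 1 - x 0 = a' ∨ x 1 - x 0 = b'))
    (hxf : IsCorner x f) (hf : E.IsInnerFace f) : False := by
  obtain ⟨c0, c1, c2, c3, e1, e2, e3⟩ := corners_of_face f
  have m0 := corner_mem_of_isInnerFace hf c0
  have m1 := corner_mem_of_isInnerFace hf c1
  have m2 := corner_mem_of_isInnerFace hf c2
  have m3 := corner_mem_of_isInnerFace hf c3
  rw [hΩ, hEδ, hbox] at m0 m1 m2 m3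
  obtain ⟨hv0, hv1⟩ := isCorner_coord hxf
  omega

include hconv hgood hΩ hEδ hbox hba hba' in
/-- **One arc is connected along the lap.** For a 2-colouring `P ⊔ Q` of the discrete boundary with at most two
`P`–`Q` edges of `Ω_δ`, each bordering an inner face at its `P`-end, the class `P` is connected inside `Ω_δ`. -/
theorem preconnected_of_colouring (P Q : Set (Site 2)) (hPQ : Disjoint P Q) (hcov : E.zdBoundary ⊆ P ∪ Q)
    (hP : P ⊆ E.zdBoundary)
    (htwo : ∀ S : Finset (Sym2 (Site 2)),
      (∀ e ∈ S, e ∈ (discreteDomainGraph Ω δ).edgeSet ∧ (∃ x ∈ e, x ∈ P) ∧ ∃ y ∈ e, y ∈ Q) → S.card ≤ 2)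
    (hinner : ∀ x y : Site 2, x ∈ P → y ∈ Q → (discreteDomainGraph Ω δ).Adj x y →
      ∃ f : Site 2, E.IsInnerFace f ∧ IsCorner x f) :
    ((discreteDomainGraph Ω δ).induce P).Preconnected := by
  obtain ⟨V, N, hN, hVfr, hVadj, hcl, hinj, hcover⟩ := diamondArcs_exists_lap a b a' b' hba hba'
  have hzfr : ∀ x : Site 2, x ∈ E.zdBoundary → (a ≤ x 0 + x 1 ∧ x 0 + x 1 ≤ b ∧ a' ≤ x 1 - x 0 ∧ x 1 - x 0 ≤ b') ∧
      (x 0 + x 1 ≤ a + 1 ∨ b - 1 ≤ x 0 + x 1 ∨ x 1 - x 0 ≤ a' + 1 ∨ b' - 1 ≤ x 1 - x 0) := fun x hx =>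
    mem_frame_of_mem_zdBoundary hconv hgood hΩ hEδ hbox hx
  have hVz : ∀ i, i ≤ N → V i ∈ E.zdBoundary := fun i hi =>
    mem_zdBoundary_of_mem_frame hconv hgood hΩ hEδ hbox hba (hVfr i hi).1 (hVfr i hi).2
  have hmem : ∀ i, i ≤ N → V i ∈ P ∪ Q := fun i hi => hcov (hVz i hi)
  have hadj : ∀ i, i < N → (discreteDomainGraph Ω δ).Adj (V i) (V (i + 1)) := fun i hi =>
    (adj_iff_of_mem_box hconv hgood hbox (hVfr i hi.le).1 (hVfr (i + 1) hi).1).2 (hVadj i hi)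
  -- every `P`-site is joined inside `P` to a lap site
  have rep : ∀ u : Site 2, ∀ hu : u ∈ P, ∃ (i : ℕ) (hi : V i ∈ P), i ≤ N ∧
      ((discreteDomainGraph Ω δ).induce P).Reachable ⟨u, hu⟩ ⟨V i, hi⟩ := by
    intro u hu
    obtain ⟨hubox, hufr⟩ := hzfr u (hP hu)
    by_cases hap : (u 0 + u 1 = a ∨ u 0 + u 1 = b) ∧ (u 1 - u 0 = a' ∨ u 1 - u 0 = b')
    · obtain ⟨y, ⟨hybox, hyfr⟩, hyap, hadjy⟩ := exists_anchor hba hba' hap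
      have hyz : y ∈ E.zdBoundary := mem_zdBoundary_of_mem_frame hconv hgood hΩ hEδ hbox hba hybox hyfr
      have huy : (discreteDomainGraph Ω δ).Adj u y := (adj_iff_of_mem_box hconv hgood hbox hubox hybox).2 hadjy
      have hyP : y ∈ P := by
        rcases hcov hyz with h | h
        · exact h
        · obtain ⟨f, hf, huf⟩ := hinner u y hu h huy
          exact (apex_no_innerFace hΩ hEδ hbox hap huf hf).elim
      obtain ⟨i, hi, rfl⟩ := hcover y hybox hyfr hyap
      exact ⟨i, hyP, hi.le, SimpleGraph.Adj.reachable (by simpa [SimpleGraph.induce_adj] using huy)⟩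
    · obtain ⟨i, hi, rfl⟩ := hcover u hubox hufr hap
      exact ⟨i, hu, hi.le, SimpleGraph.Reachable.refl _⟩
  intro u v
  obtain ⟨i, hi, hiN, ri⟩ := rep u.1 u.2
  obtain ⟨j, hj, hjN, rj⟩ := rep v.1 v.2
  have rij := diamondArcs_reachable_of_lap (discreteDomainGraph Ω δ) P Q V N hN hPQ hmem hadj hcl hinj htwo i j hi hj
    hiN hjN
  exact ri.trans (rij.trans rj.symm)

include hconv hgood hΩ hEδ hbox hba hba' in
/-- **Both discrete arcs of an admissible box datum are connected** (`A` through `Ω_δ`, `B` through `ℤ²`). -/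
theorem arcs_preconnected (hE : E.IsZdAdmissible) :
    ((discreteDomainGraph Ω δ).induce E.zdArcA).Preconnected ∧ ((zdGraph 2).induce E.zdArcB).Preconnected := by
  have hG : discreteDomainGraph E.Ω E.δ = discreteDomainGraph Ω δ := by rw [hΩ, hEδ]
  -- at most two `A`–`B` edges, each on an inner face
  have htwo : ∀ S : Finset (Sym2 (Site 2)), (∀ e ∈ S, e ∈ (discreteDomainGraph Ω δ).edgeSet ∧
      (∃ x ∈ e, x ∈ E.zdArcA) ∧ ∃ y ∈ e, y ∈ E.zdArcB) → S.card ≤ 2 := by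
    intro S hS
    have hsub : (S : Set (Sym2 (Site 2))) ⊆ E.zdABEdges := fun e he => by
      rw [Finset.mem_coe] at he
      rw [mem_zdABEdges_iff, hG]
      exact hS e he
    have hfin : E.zdABEdges.Finite := Set.finite_of_ncard_ne_zero (by rw [hE.ncard_zdABEdges_eq_two]; decide)
    have := Set.ncard_le_ncard hsub hfin
    rwa [Set.ncard_coe_finset, hE.ncard_zdABEdges_eq_two] at this
  have hinner : ∀ x y : Site 2, x ∈ E.zdArcA → y ∈ E.zdArcB → (discreteDomainGraph Ω δ).Adj x y →
      ∃ f : Site 2, E.IsInnerFace f ∧ IsCorner x f ∧ IsCorner y f := by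
    intro x y hx hy hxy
    have he : s(x, y) ∈ E.zdABEdges := by
      rw [mem_zdABEdges_iff, hG]
      exact ⟨(SimpleGraph.mem_edgeSet _).2 hxy, ⟨x, Sym2.mem_mk_left _ _, hx⟩, ⟨y, Sym2.mem_mk_right _ _, hy⟩⟩
    obtain ⟨f, ⟨hf, hcf⟩, -⟩ := hE.zdABEdges_inner _ he
    exact ⟨f, hf, hcf x (Sym2.mem_mk_left _ _), hcf y (Sym2.mem_mk_right _ _)⟩
  constructor
  · refine preconnected_of_colouring hconv hgood hΩ hEδ hbox hba hba' E.zdArcA E.zdArcB hE.disjoint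
      hE.zdBoundary_subset E.zdArcA_subset_zdBoundary htwo fun x y hx hy hxy => ?_
    obtain ⟨f, hf, hxf, -⟩ := hinner x y hx hy hxy
    exact ⟨f, hf, hxf⟩
  · have hB : ((discreteDomainGraph Ω δ).induce E.zdArcB).Preconnected := by
      refine preconnected_of_colouring hconv hgood hΩ hEδ hbox hba hba' E.zdArcB E.zdArcA hE.disjoint.symm
        (by rw [Set.union_comm]; exact hE.zdBoundary_subset) E.zdArcB_subset_zdBoundary (fun S hS => htwo S ?_)
        fun x y hx hy hxy => ?_
      · intro e he
        obtain ⟨h1, h2, h3⟩ := hS e he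
        exact ⟨h1, h3, h2⟩
      · obtain ⟨f, hf, -, hxf⟩ := hinner y x hy hx hxy.symm
        exact ⟨f, hf, hxf⟩
    -- connectivity through `Ω_δ` implies connectivity through `ℤ²`
    have hle : discreteDomainGraph Ω δ ≤ zdGraph 2 := fun _ _ h =>
      meshGraph_le_zdGraph Ω δ (discreteDomainGraph_le_meshGraph Ω δ h)
    let φ : (discreteDomainGraph Ω δ).induce E.zdArcB →g (zdGraph 2).induce E.zdArcB :=
      SimpleGraph.induceHom (SimpleGraph.Hom.ofLE hle) (Set.mapsTo_id _)
    intro u v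
    exact (hB u v).map φ

end Core

end ArcsConn

open ArcsConn

/-- **S1c — the discrete arcs of a diamond discretisation are connected, eventually** ((H1)/(H2) of
`passesCorner_iff_reachable_of_touch`): along an admissible family of a marked diamond, for all small `δ` the wired
discrete arc is connected through `Ω_δ` and the dual-wired one through lattice edges. -/
theorem stub_diamondArcsConnected : DiamondArcsConnected := by
  intro D hD Λ hΛ
  obtain ⟨c, α, β, hα, hβ, hcar⟩ := hD
  obtain ⟨hΩ, hδ, -, -, -, hadm⟩ := hΛ
  have hgood := eventually_mem_meshDomain_of_isMarkedDiamond D ⟨c, α, β, hα, hβ, hcar⟩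
  have hconv : Convex ℝ D.carrier := by rw [hcar]; exact convex_tiltedBox c _ α β
  have h4 : (0 : ℝ) < min α β / 4 := by positivity
  filter_upwards [hadm, hgood, Ioo_mem_nhdsGT h4] with δ hadm hgood hδs
  obtain ⟨hδ0, hδ4⟩ := hδs
  obtain ⟨a, b, a', b', hba, hba', hbox⟩ := diamondArcs_exists_box c α β δ hδ0
    (by linarith [min_le_left α β]) (by linarith [min_le_right α β])
  have hbox' : ∀ x : Site 2, meshPoint δ x ∈ D.carrier ↔
      (a ≤ x 0 + x 1 ∧ x 0 + x 1 ≤ b ∧ a' ≤ x 1 - x 0 ∧ x 1 - x 0 ≤ b') := fun x => by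
    rw [hcar, Set.mem_setOf_eq]; exact hbox x
  exact arcs_preconnected hconv hgood (hΩ δ) (hδ δ) hbox' hba hba' hadm

end Summit.CriticalPhenomena.CardyFormulaZ2.Cruxes.ParafermionToSLESixFamilies.PotentialDarbouxPicardDiamond

end
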